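import Summits.BirchSwinnertonDyer.BirchSwinnertonDyer.Theorems.EisensteinDepletionAtTwoStarE1MNSFDoor
import Summits.BirchSwinnertonDyer.BirchSwinnertonDyer.Theorems.EisensteinDepletionAtTwoStarSigmaGlue
import Summits.BirchSwinnertonDyer.BirchSwinnertonDyer.Theorems.EisensteinDepletionAtTwoStarOptBSFOddCover
import HarnessLib

/-!
# Line `star` on crux E1M (stmt-BirchSwinnertonDyer-20341): the DOOR THROUGH THE EVEN-INDEX HALF — `StarOptB` and E1M from the single
# research statement «StarOptB at squarefree `N ≠ 15`, even Shimura index» plus the three prints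

Lead star-p1 GEN 15.  The registered skeleton Lines/star.lean v7 as landed glue: its only research stub `stub_starOptBSFEven` is taken here as an
explicit hypothesis (stated inline, verbatim), and the kernel-checked composition gives
* `starOptB_of_evenHalf_of_print` — `StarOptB` (aside item 24445, all levels) ⇐ even half ∧ Modularity ∧ CES `Γ₁(N)`-datum ∧ UBD
  (odd index: `SfOddCover.starOptB_oddIndex_of_print`; non-squarefree: `NsfDoorPrint.starOptBNSF_of_print`);
* `depletedLambdaLawAtTwoMod_of_evenHalf_of_print` — E1M `DepletedLambdaLawAtTwoMod` (item 20341) ⇐ even half ∧ CES datum ∧ Abbes–Ullmo ∧ UBD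
  (modularity is E1M's own binder; `KummerDoor.starGO2Sigma_of_modularity_abbesUllmo_ubd` + the Σ-glue).
So whoever proves the even half closes 24445 and 20341 by modus ponens with these theorems (the closer pattern of GEN 14's `E1MNSFOfInputs`).
CONDITIONAL (the even half is OPEN; the prints are named facts); no `sorry`, no new definition; nothing here reads `r_an`; BSD is NOT proved by this file.
-/

set_option linter.dupNamespace false
set_option autoImplicit false

noncomputable section

namespace Summit.BirchSwinnertonDyer.BirchSwinnertonDyer.Theorems.DepletionAtTwo.SfEvenDoor

open Literature.NumberTheory.EllipticCurves
open Literature.NumberTheory.EllipticCurves.Greenberg1999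
open Literature.NumberTheory.EllipticCurves.ModularForms
open Summit.BirchSwinnertonDyer.BirchSwinnertonDyer.Theorems.DepletionAtTwo

/-- **`StarOptB` from the even-index half and the three prints.**  Hypothesis `hE` is VERBATIM the registered research stub `stub_starOptBSFEven`
of Lines/star.lean v7 («StarOptB at squarefree `N ≠ 15` for classes with no odd `d`, `dΛ_f ⊆ Λ₁(f)`»); the odd-index classes are
`SfOddCover.starOptB_oddIndex_of_print`, the non-squarefree ones `NsfDoorPrint.starOptBNSF_of_print`. CONDITIONAL.
[cite: Stevens1989, §2] [cite: CalegariDimitrovTang2025, Thm. 1.0.1] [cite: ConradEdixhovenStein2003, §6.1 Lemma 6.1.6] -/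
theorem starOptB_of_evenHalf_of_print
    (hE : ∀ (W : WeierstrassCurve ℚ) [W.IsElliptic] [W.IsGloballyMinimal] (x : ℚ), IsOrdinaryAt W 2 →
      HasUniqueRationalTwoTorsionX W x →
      ((TwoTorsionRamifiedAtTwo x ∧ ¬ TwoTorsionOdd W x) ∨ (TwoTorsionOdd W x ∧ ¬ TwoTorsionRamifiedAtTwo x)) →
      W.conductorNorm ℤ ≠ 15 → Squarefree (W.conductorNorm ℤ) →
      ∀ ⦃N : ℕ⦄ [NeZero N] (f : CuspForm (CongruenceSubgroup.Gamma0 N) 2), IsNewformOf W f →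
      (¬ ∃ d : ℕ, Odd d ∧ ∀ w ∈ periodLattice f, (d : ℂ) * w ∈ periodLatticeGamma1 f) →
      ∀ (W₀ : WeierstrassCurve ℚ) [W₀.IsElliptic] [W₀.IsGloballyMinimal], IsNewformOf W₀ f →
      ∀ (L₀ : PeriodPair), IsNeronLatticeOf (W₀.baseChange ℂ) L₀ → ∀ (q : ℚ), q ≠ 0 →
      (∀ z ∈ periodLattice f, (q : ℂ) * z ∈ L₀.lattice) → (∀ z ∈ L₀.lattice, ∃ w ∈ periodLattice f, z = (q : ℂ) * w) →
      ∃ x₀ : ℚ, HasRationalTwoTorsionX W₀ x₀ ∧ TwoTorsionOdd W₀ x₀ ∧ ¬ TwoTorsionRamifiedAtTwo x₀)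
    (hnf : exists_isNewformOf) (hex : exists_optimal_gamma1ParametrizationData)
    (hU : Literature.NumberTheory.Automorphic.CalegariDimitrovTang2025_unboundedDenominators) :
    Summit.BirchSwinnertonDyer.BirchSwinnertonDyer.Theses.EisensteinDepletionAtTwo.StarOptB := by
  intro W _ _ x hord hx hAB h15 N _ f hf W₀ _ _ hf₀ L₀ hL₀ q hq hin hout
  by_cases hsf : Squarefree (W.conductorNorm ℤ)
  · by_cases hodd : ∃ d : ℕ, Odd d ∧ ∀ w ∈ periodLattice f, (d : ℂ) * w ∈ periodLatticeGamma1 f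
    · exact SfOddCover.starOptB_oddIndex_of_print hnf hex hU W x hord hx hAB f hf hodd W₀ hf₀ L₀ hL₀ q hq hin hout
    · exact hE W x hord hx hAB h15 hsf f hf hodd W₀ hf₀ L₀ hL₀ q hq hin hout
  · exact NsfDoorPrint.starOptBNSF_of_print hnf hex hU W x hord hx hAB h15 hsf f hf W₀ hf₀ L₀ hL₀ q hq hin hout

/-- **E1M `DepletedLambdaLawAtTwoMod` (item 20341) from the even-index half and the prints** CES `Γ₁(N)`-datum, Abbes–Ullmo, UBD (modularity is the
crux's own binder): `KummerDoor.starGO2Sigma_of_modularity_abbesUllmo_ubd` (line kummer), `starOptB_of_evenHalf_of_print`, and the Σ-glue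
`depletedLambdaLawAtTwoMod_of_starGO2Sigma`.  This is Lines/star.lean v7's `DepletedLambdaLawAtTwoMod_of` as a tree theorem. CONDITIONAL.
[cite: GreenbergVatsal2000, §3 Thm. (3.12)] [cite: AbbesUllmo1996, Thm. A] [cite: CalegariDimitrovTang2025, Thm. 1.0.1] -/
theorem depletedLambdaLawAtTwoMod_of_evenHalf_of_print
    (hE : ∀ (W : WeierstrassCurve ℚ) [W.IsElliptic] [W.IsGloballyMinimal] (x : ℚ), IsOrdinaryAt W 2 →
      HasUniqueRationalTwoTorsionX W x →
      ((TwoTorsionRamifiedAtTwo x ∧ ¬ TwoTorsionOdd W x) ∨ (TwoTorsionOdd W x ∧ ¬ TwoTorsionRamifiedAtTwo x)) →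
      W.conductorNorm ℤ ≠ 15 → Squarefree (W.conductorNorm ℤ) →
      ∀ ⦃N : ℕ⦄ [NeZero N] (f : CuspForm (CongruenceSubgroup.Gamma0 N) 2), IsNewformOf W f →
      (¬ ∃ d : ℕ, Odd d ∧ ∀ w ∈ periodLattice f, (d : ℂ) * w ∈ periodLatticeGamma1 f) →
      ∀ (W₀ : WeierstrassCurve ℚ) [W₀.IsElliptic] [W₀.IsGloballyMinimal], IsNewformOf W₀ f →
      ∀ (L₀ : PeriodPair), IsNeronLatticeOf (W₀.baseChange ℂ) L₀ → ∀ (q : ℚ), q ≠ 0 →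
      (∀ z ∈ periodLattice f, (q : ℂ) * z ∈ L₀.lattice) → (∀ z ∈ L₀.lattice, ∃ w ∈ periodLattice f, z = (q : ℂ) * w) →
      ∃ x₀ : ℚ, HasRationalTwoTorsionX W₀ x₀ ∧ TwoTorsionOdd W₀ x₀ ∧ ¬ TwoTorsionRamifiedAtTwo x₀)
    (hex : exists_optimal_gamma1ParametrizationData) (hAU : abbesUllmo_not_dvd_maninConstant_of_not_dvd_level)
    (hU : Literature.NumberTheory.Automorphic.CalegariDimitrovTang2025_unboundedDenominators) :
    Summit.BirchSwinnertonDyer.BirchSwinnertonDyer.Theses.EisensteinDepletionAtTwo.DepletedLambdaLawAtTwoMod := by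
  intro hmod
  have hnf : exists_isNewformOf := hmod
  exact depletedLambdaLawAtTwoMod_of_starGO2Sigma (KummerDoor.starGO2Sigma_of_modularity_abbesUllmo_ubd hnf hAU hU)
    (starOptB_of_evenHalf_of_print hE hnf hex hU) hmod

end Summit.BirchSwinnertonDyer.BirchSwinnertonDyer.Theorems.DepletionAtTwo.SfEvenDoor

end
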